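import Mathlib
import HarnessLib
import Summits.Ventures.LatticeQCDFlow.Scaling.ProtocolDecorrelation
import Summits.Ventures.LatticeQCDFlow.Scaling.GeneralLayerLagLawUniform
import Literature.NumberTheory.LFunctions.MatomakiRadziwillTaoMajorArc

/-!
# GeneralLayerWorkVariance — the WORK-VARIANCE law for arbitrary relaxation layers: along the
# uniform `n`-step switching protocol, `Var_path(W) ≤ (1/n)(σ̄ + ε̄)(σ̄(1+θ)/(1−θ) + ε̄(1+√θ)/(1−√θ))`,
# `ε̄ = O(n^{−1/2})` — E7's `Var W = k′ n_dof/n_step`, `k′ = 2τ_int·σ²Δ²`, as a certified upper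
# envelope with `2τ̄ = (1+θ)/(1−θ)` of the slowest mode

HONEST FRAMING: exact (Metropolis-corrected) sampling algorithms for lattice gauge theory;
figures of merit are autocorrelation/cost numbers at stated couplings and volumes; no
continuum-physics claim.

Venture `LatticeQCDFlow` (cell pub-lqcd), topic `Scaling`; FANOUT row 19 (`su2-snf`, GEN-5).
OUR WORK (elementary finite sums), nothing cited as a fact.  Setting and hypotheses of the
general-layer lag law (`Scaling/GeneralLayerLagLaw{,Uniform}`: linear protocol `S_c = S₀ + c•D`,
uniform grid `c_j = j/n`, `|D x − D y| ≤ ΔD`, `Var_c(D) ≤ σ̄²`, layers `χ²`-contracting towards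
their targets with `ρ`, `θ = ρ·e^{ΔD/(2n)} < 1`), plus: the layers are STOCHASTIC (non-negative)
and leave their targets invariant (then the law-side `χ²`-contraction IS the Literature's `L²₀(π)`
forward-operator bound `FwdNormSqLE π P (ρ²)`, bridged in `Scaling/ProtocolDecorrelation`;
`ρ = λ⋆` for reversible irreducible layers).  E7's `−log ESS = Var W = k′n_dof/n_step` is a
statement about the VARIANCE of the work.  Here:

* `layerWorkVar S₀ D c P n` — `Var_path(W)` of the protocol with general layers;
  **`layerWorkVar_eq_sum_sum`** — `Var_path(W) = Σ_{j,k<n} δ_jδ_k·E[(D(ω_j) − m_j)(D(ω_k) − m_k)]`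
  (`m_j = E_{μ_j}[D]`; any grid, any layers with unit row sums);
* **`abs_twoTime_cov_le`** — THE TWO-TIME COVARIANCE BOUND: for `j ≤ k = j + m`,
  `|E[(D(ω_j) − m_j)(D(ω_k) − m_k)]| ≤ (σ̄ + ε̄)(σ̄θ^m + ε̄(√θ)^m)`,
  `ε̄ = √((θ/(1−θ))(σ̄/n)·ΔD·σ̄)` (two-time marginalisation, Cauchy–Schwarz, second-moment
  transfer at the `√χ²` cost of `GeneralLayerLagLawUniform`, geometric decorrelation rate `θ²`);
* **`layerWorkVar_uniform_le`** — THE GENERAL-LAYER WORK-VARIANCE LAW: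
  `Var_path(W) ≤ (1/n)·(σ̄ + ε̄)·(σ̄·(1+θ)/(1−θ) + ε̄·(1+√θ)/(1−√θ))`; since `ε̄ = O(n^{−1/2})`,
  `n·Var_path(W) ≲ 2τ̄·σ̄²`, `τ̄ = (1+ρ)/(2(1−ρ))` (slowest mode): E7's fitted `k′ = 2τ_int·(drop
  variance)` is a CERTIFIED UPPER ENVELOPE for the work variance of every such layer family (the
  lazy / AR(1) classes attain the form) — with the mean-work law, both moments of the Gaussian-work
  dictionary `−log ESS ≈ Var W ≈ 2(⟨W⟩ − ΔF)` are now bounded for arbitrary layers;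
* `layerWorkVar_uniform_le_of_reversible` — the instance for stochastic layers reversible for
  their targets and irreducible, `ρ = max_k λ⋆(P_k)` (stationarity from detailed balance).

NOT CLAIMED: the ESS itself for general layers; any value of `ρ`, `σ̄`; tightness.
-/

namespace Summit.Ventures.LatticeQCDFlow.Scaling

open Finset
open Literature.Probability.MarkovChains (IsRowStochastic IsStationary stepLaw DetailedBalance
  IsIrreducible lambdaStar lawVariance lawMean lambdaStar_nonneg absSpectralGap
  LevinPeres2017_eq_12_8 stepLaw_nonneg FwdNormSqLE)
open Literature.Probability.ImportanceSampling (chiSqDiv chiSqDiv_def chiSqDiv_eq_sum_sq_div)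
open Summit.Ventures.LatticeQCDFlow.Exactness
open Summit.Ventures.LatticeQCDFlow.Theory2

variable {X : Type*} [Fintype X]

/-! ## The work variance with general layers -/

/-- `Var_path(W)`: the variance of the work of the `n`-step linear protocol with general layers
(path law started in equilibrium at `c 0`). -/
noncomputable def layerWorkVar (S₀ D : X → ℝ) (c : ℕ → ℝ) (P : ℕ → X → X → ℝ) (n : ℕ) : ℝ :=
  ∑ ω : Fin (n + 1) → X, pathLaw (gibbsLaw (linAction S₀ D (c 0))) (fun k : Fin n => P k) ω
    * (work (fun k : Fin (n + 1) => linAction S₀ D (c k)) ω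
        - ∑ ω' : Fin (n + 1) → X,
            pathLaw (gibbsLaw (linAction S₀ D (c 0))) (fun k : Fin n => P k) ω'
              * work (fun k : Fin (n + 1) => linAction S₀ D (c k)) ω') ^ 2

/-- **The work variance is the double sum of two-time covariances of the switch observable**:
`Var_path(W) = Σ_{j,k<n} δ_j δ_k E[(D(ω_j) − m_j)(D(ω_k) − m_k)]`, `m_j = E_{μ_j}[D]`. -/
theorem layerWorkVar_eq_sum_sum [Nonempty X] (S₀ D : X → ℝ) (c : ℕ → ℝ) (P : ℕ → X → X → ℝ)
    (hP : ∀ k x, ∑ y, P k x y = 1) (n : ℕ) :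
    layerWorkVar S₀ D c P n
      = ∑ j : Fin n, ∑ k : Fin n, (c (j + 1) - c j) * (c (k + 1) - c k)
          * ∑ ω : Fin (n + 1) → X,
              pathLaw (gibbsLaw (linAction S₀ D (c 0))) (fun k : Fin n => P k) ω
                * ((D (ω (Fin.castSucc j))
                      - ∑ y, evolveLaw P (gibbsLaw (linAction S₀ D (c 0))) j y * D y)
                    * (D (ω (Fin.castSucc k))
                      - ∑ y, evolveLaw P (gibbsLaw (linAction S₀ D (c 0))) k y * D y)) := by
  set μ₀ := gibbsLaw (linAction S₀ D (c 0)) with hμ₀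
  set mD : ℕ → ℝ := fun j => ∑ y, evolveLaw P μ₀ j y * D y with hmD
  -- the mean work, in `Fin`-sum form
  have hEW : ∑ ω' : Fin (n + 1) → X, pathLaw μ₀ (fun k : Fin n => P k) ω'
        * work (fun k : Fin (n + 1) => linAction S₀ D (c k)) ω'
      = ∑ k : Fin n, (c (k + 1) - c k) * mD k := by
    have h := meanWork_eq_sum_evolveLaw n μ₀ (fun k => linAction S₀ D (c k)) P hP
    beta_reduce at h
    rw [h, ← Fin.sum_univ_eq_sum_range]
    refine sum_congr rfl fun k _ => ?_
    rw [hmD]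
    simp only [mul_sum]
    refine sum_congr rfl fun y _ => ?_
    simp only [linAction]
    ring
  -- the centred work as a `Fin` sum
  have hcen : ∀ ω : Fin (n + 1) → X,
      work (fun k : Fin (n + 1) => linAction S₀ D (c k)) ω - ∑ k : Fin n, (c (k + 1) - c k) * mD k
        = ∑ k : Fin n, (c (k + 1) - c k) * (D (ω (Fin.castSucc k)) - mD k) := by
    intro ω
    unfold work
    simp only [Fin.val_succ, Fin.val_castSucc, linAction]
    rw [← sum_sub_distrib]
    exact sum_congr rfl fun k _ => by ring
  unfold layerWorkVar
  rw [hEW]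
  simp_rw [hcen, sq, Finset.sum_mul_sum, mul_sum]
  rw [sum_comm]
  refine sum_congr rfl fun j _ => ?_
  rw [sum_comm]
  refine sum_congr rfl fun k _ => ?_
  exact sum_congr rfl fun ω _ => by ring

/-- **Two-time covariance bound along the uniform protocol.**  Under the hypotheses of the
general-layer law plus STOCHASTIC layers leaving their targets invariant (so that the `χ²`-contraction
is also the function-side bound `FwdNormSqLE`, `ProtocolDecorrelation.fwdNormSqLE_of_chiSqContracts`),
for steps `j ≤ k = j + m`:
`|E[(D(ω_j) − m_j)(D(ω_k) − m_k)]| ≤ (σ̄ + ε̄)·(σ̄·θ^m + ε̄·(√θ)^m)`, where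
`θ = ρ·e^{ΔD/(2n)}` and `ε̄ = √((θ/(1−θ))·(σ̄/n)·ΔD·σ̄)` is the `√χ²`-price of replacing the
marginal `μ_j` by the equilibrium law (`ε̄ → 0` as `n → ∞`). -/
theorem abs_twoTime_cov_le [Nonempty X] (S₀ D : X → ℝ) (P : ℕ → X → X → ℝ)
    (hP : ∀ k, IsRowStochastic (P k)) {n : ℕ} (hn : n ≠ 0) {ΔD ρ σbar θ εbar : ℝ}
    (hD : ∀ x y, |D x - D y| ≤ ΔD)
    (hK : ∀ k, ChiSqContracts (P k) (gibbsLaw (linAction S₀ D (((k + 1 : ℕ) : ℝ) / n))) ρ)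
    (hst : ∀ k, IsStationary
      (fun x => Real.exp (-(linAction S₀ D (((k + 1 : ℕ) : ℝ) / n) x))) (P k))
    (hρ : 0 ≤ ρ) (hσ0 : 0 ≤ σbar) (hσ : ∀ c, varD S₀ D c ≤ σbar ^ 2)
    (hθ : θ = ρ * Real.exp (ΔD / (2 * n))) (hθ1 : θ < 1)
    (hε : εbar = Real.sqrt (θ / (1 - θ) * (σbar / n) * ΔD * σbar))
    (j k : Fin (n + 1)) (m : ℕ) (hk : (k : ℕ) = j + m) :
    |∑ ω : Fin (n + 1) → X,
        pathLaw (gibbsLaw (linAction S₀ D 0)) (fun k : Fin n => P k) ω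
          * ((D (ω j) - ∑ y, evolveLaw P (gibbsLaw (linAction S₀ D 0)) j y * D y)
              * (D (ω k) - ∑ y, evolveLaw P (gibbsLaw (linAction S₀ D 0)) k y * D y))|
      ≤ (σbar + εbar) * (σbar * θ ^ m + εbar * Real.sqrt θ ^ m) := by
  set abar := θ / (1 - θ) * (σbar / n) with habar
  set μ₀ := gibbsLaw (linAction S₀ D 0) with hμ₀
  set μj := evolveLaw P μ₀ j with hμj
  set πj := gibbsLaw (linAction S₀ D ((j : ℝ) / n)) with hπj
  set h := propagate (fun i => P (j + i)) m D with hh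
  have hθ0 : 0 ≤ θ := by rw [hθ]; positivity
  have hθ1' : ρ * Real.exp (ΔD / (2 * n)) < 1 := hθ ▸ hθ1
  have h1θ : 0 < 1 - θ := sub_pos.mpr hθ1
  have habar0 : 0 ≤ abar := by positivity
  have hΔD0 : 0 ≤ ΔD := (abs_nonneg _).trans (hD (Classical.arbitrary X) (Classical.arbitrary X))
  have hε0 : 0 ≤ εbar := by rw [hε]; exact Real.sqrt_nonneg _
  have hεsq : εbar ^ 2 = abar * (ΔD * σbar) := by
    rw [hε, Real.sq_sqrt (by positivity), habar]; ring
  have hProw : ∀ k x, ∑ y, P k x y = 1 := fun k => (hP k).2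
  have hn' : (0 : ℝ) < n := Nat.cast_pos.mpr (Nat.pos_of_ne_zero hn)
  -- masses, non-negativity of the marginal
  have hμj1 : ∑ x, μj x = 1 := by rw [hμj, sum_evolveLaw P hProw, hμ₀, sum_gibbsLaw]
  have hμj0 : ∀ x, 0 ≤ μj x := by
    have : ∀ t x, 0 ≤ evolveLaw P μ₀ t x := by
      intro t
      induction t with
      | zero => intro x; exact (gibbsLaw_pos _ x).le
      | succ t ih => intro x; rw [evolveLaw_succ]; exact stepLaw_nonneg (hP t) ih x
    exact this j
  -- two-time marginalisation and centring
  have htwo := sum_pathLaw_mul_mul_apply n μ₀ P hProw j k m hk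
    (fun x => D x - ∑ y, μj y * D y) (fun x => D x - ∑ y, evolveLaw P μ₀ k y * D y)
  have hprop : ∀ x, propagate (fun i => P (j + i)) m
      (fun x => D x - ∑ y, evolveLaw P μ₀ k y * D y) x = h x - ∑ y, μj y * h y := by
    intro x
    rw [propagate_sub_const m _ (fun t x => hProw (j + t) x), hh]
    congr 1
    rw [sum_mul_propagate, ← evolveLaw_add P μ₀ j m, ← hk]
  rw [htwo]
  simp_rw [hprop]
  -- Cauchy–Schwarz under μ_j
  have hcs := abs_sum_mul_mul_le hμj0 (fun x => D x - ∑ y, μj y * D y)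
    (fun x => h x - ∑ y, μj y * h y)
  have haj : Real.sqrt (chiSqDiv μj πj) ≤ abar := by
    have := sqrt_chiSqDiv_evolveLaw_uniform_le S₀ D P hProw hn hD hK hρ hσ0 hσ hθ1' j
    rwa [← hθ] at this
  -- first factor: Var_{μ_j}(D) ≤ σ̄² + ā ΔD σ̄
  have hVD : ∑ x, μj x * (D x - ∑ y, μj y * D y) ^ 2 ≤ σbar ^ 2 + abar * (ΔD * σbar) := by
    have h1 := sum_mul_sq_sub_mean_le hμj1 D (∑ y, πj y * D y)
    have h2 := sum_mul_sq_le_add_sqrt_chiSqDiv (π := πj) (φ := D) (c := ∑ y, πj y * D y)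
      (gibbsLaw_pos (linAction S₀ D ((j : ℝ) / n))) hμj1
      (sum_gibbsLaw (linAction S₀ D ((j : ℝ) / n)))
      (abs_sub_mean_le (fun y => (gibbsLaw_pos (linAction S₀ D ((j : ℝ) / n)) y).le)
        (sum_gibbsLaw (linAction S₀ D ((j : ℝ) / n))) hD)
    have hVeq : ∑ x, πj x * (D x - ∑ y, πj y * D y) ^ 2 = varD S₀ D ((j : ℝ) / n) := by
      unfold varD; rw [varLaw_eq_sum_sq_dev (sum_gibbsLaw _)]
    rw [hVeq] at h2
    have h3 := transfer_bound_mono (V' := σbar ^ 2) (hσ ((j : ℝ) / n)) (Real.sqrt_nonneg _)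
      haj hΔD0
    rw [Real.sqrt_sq hσ0] at h3
    linarith
  -- second factor: Var_{π_j}(h) ≤ θ^{2m} σ̄², then Var_{μ_j}(h) ≤ θ^{2m} σ̄² + ā ΔD θ^m σ̄
  have hosc_h : ∀ x y, |h x - h y| ≤ ΔD :=
    abs_propagate_sub_le m _ (fun t => hP (j + t)) hD
  have hVh_le : lawVariance πj h ≤ θ ^ (2 * m) * σbar ^ 2 := by
    have hprop2 := lawVariance_propagate_le m (fun i => P (j + i))
      (fun i => gibbsLaw (linAction S₀ D (((j + i : ℕ) : ℝ) / n))) (ρ := ρ)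
      (R := Real.exp (ΔD / n))
      (fun i => fwdNormSqLE_of_chiSqContracts (gibbsLaw_pos _) (sum_gibbsLaw _)
        (isStationary_gibbsLaw_of_exp (hst (j + i))) (hK (j + i)))
      (fun i x => hProw (j + i) x) (fun i => sum_gibbsLaw _) (Real.exp_pos _).le
      (fun i x => by
        have hle := gibbsLaw_linAction_le_exp_mul S₀ D hD (((j + i : ℕ) : ℝ) / n)
          (((j + (i + 1) : ℕ) : ℝ) / n) x
        have e : |(((j + (i + 1) : ℕ) : ℝ) / n) - ((j + i : ℕ) : ℝ) / n| * ΔD = ΔD / n := by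
          rw [show ((j + (i + 1) : ℕ) : ℝ) = ((j + i : ℕ) : ℝ) + 1 by push_cast; ring,
            add_div, add_sub_cancel_left, abs_of_pos (by positivity)]
          field_simp
        rw [e] at hle
        exact hle) D
    have eθ : Real.exp (ΔD / n) * ρ ^ 2 = θ ^ 2 := by
      rw [hθ, mul_pow, ← Real.exp_nat_mul]
      rw [show ((2 : ℕ) : ℝ) * (ΔD / (2 * n)) = ΔD / n by push_cast; field_simp]
      ring
    have hlast : lawVariance (gibbsLaw (linAction S₀ D (((j + m : ℕ) : ℝ) / n))) D ≤ σbar ^ 2 := by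
      rw [lawVariance_eq_varLaw (sum_gibbsLaw _)]
      exact hσ _
    have h0 : gibbsLaw (linAction S₀ D (((j + 0 : ℕ) : ℝ) / n)) = πj := by
      simp [hπj]
    rw [h0, eθ, ← pow_mul] at hprop2
    exact hprop2.trans (mul_le_mul_of_nonneg_left hlast (pow_nonneg hθ0 _))
  have hVh : ∑ x, μj x * (h x - ∑ y, μj y * h y) ^ 2
      ≤ θ ^ (2 * m) * σbar ^ 2 + abar * (ΔD * (θ ^ m * σbar)) := by
    have h1 := sum_mul_sq_sub_mean_le hμj1 h (∑ y, πj y * h y)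
    have h2 := sum_mul_sq_le_add_sqrt_chiSqDiv (π := πj) (φ := h) (c := ∑ y, πj y * h y)
      (gibbsLaw_pos (linAction S₀ D ((j : ℝ) / n))) hμj1
      (sum_gibbsLaw (linAction S₀ D ((j : ℝ) / n)))
      (abs_sub_mean_le (fun y => (gibbsLaw_pos (linAction S₀ D ((j : ℝ) / n)) y).le)
        (sum_gibbsLaw (linAction S₀ D ((j : ℝ) / n))) hosc_h)
    have hVeq : ∑ x, πj x * (h x - ∑ y, πj y * h y) ^ 2 = lawVariance πj h := rfl
    rw [hVeq] at h2
    have h3 := transfer_bound_mono (V' := θ ^ (2 * m) * σbar ^ 2) hVh_le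
      (Real.sqrt_nonneg _) haj hΔD0
    have hs : Real.sqrt (θ ^ (2 * m) * σbar ^ 2) = θ ^ m * σbar := by
      rw [show θ ^ (2 * m) * σbar ^ 2 = (θ ^ m * σbar) ^ 2 by ring,
        Real.sqrt_sq (mul_nonneg (pow_nonneg hθ0 m) hσ0)]
    rw [hs] at h3
    linarith
  -- assemble
  have hA1 : Real.sqrt (∑ x, μj x * (D x - ∑ y, μj y * D y) ^ 2) ≤ σbar + εbar := by
    refine (Real.sqrt_le_sqrt hVD).trans ?_
    refine (Literature.NumberTheory.LFunctions.MRT2015.sqrt_add_le_sqrt_add_sqrt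
      (sq_nonneg _) (by positivity)).trans ?_
    rw [Real.sqrt_sq hσ0, ← hεsq, Real.sqrt_sq hε0]
  have hA2 : Real.sqrt (∑ x, μj x * (h x - ∑ y, μj y * h y) ^ 2)
      ≤ σbar * θ ^ m + εbar * Real.sqrt θ ^ m := by
    refine (Real.sqrt_le_sqrt hVh).trans ?_
    refine (Literature.NumberTheory.LFunctions.MRT2015.sqrt_add_le_sqrt_add_sqrt
      (by positivity) (by positivity)).trans ?_
    have e1 : Real.sqrt (θ ^ (2 * m) * σbar ^ 2) = σbar * θ ^ m := by
      rw [show θ ^ (2 * m) * σbar ^ 2 = (σbar * θ ^ m) ^ 2 by ring,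
        Real.sqrt_sq (mul_nonneg hσ0 (pow_nonneg hθ0 m))]
    have e2 : Real.sqrt (abar * (ΔD * (θ ^ m * σbar))) = εbar * Real.sqrt θ ^ m := by
      rw [show abar * (ΔD * (θ ^ m * σbar)) = εbar ^ 2 * θ ^ m by rw [hεsq]; ring,
        Real.sqrt_mul (sq_nonneg _), Real.sqrt_sq hε0,
        show Real.sqrt (θ ^ m) = Real.sqrt θ ^ m by
          rw [show θ ^ m = (Real.sqrt θ ^ m) ^ 2 by
            rw [← pow_mul, mul_comm, pow_mul, Real.sq_sqrt hθ0],
            Real.sqrt_sq (pow_nonneg (Real.sqrt_nonneg θ) m)]]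
    rw [e1, e2]
  exact hcs.trans (mul_le_mul hA1 hA2 (Real.sqrt_nonneg _) (by positivity))

/-- **THE GENERAL-LAYER WORK-VARIANCE LAW (uniform grid).**  Stochastic layers leaving their
targets invariant and contracting `χ²` towards them with coefficient `ρ` (`ρ = λ⋆` for reversible
irreducible layers), `|D x − D y| ≤ ΔD`, `Var_c(D) ≤ σ̄²`, `θ = ρ·e^{ΔD/(2n)} < 1`:
`Var_path(W) ≤ (1/n)·(σ̄ + ε̄)·(σ̄·(1+θ)/(1−θ) + ε̄·(1+√θ)/(1−√θ))`,
`ε̄ = √((θ/(1−θ))(σ̄/n)ΔD·σ̄) = O(n^{−1/2})`.  Leading term `2τ̄·σ̄²/n` with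
`τ̄ = (1+θ)/(2(1−θ))`: E7's fitted `Var W = 2⟨W_d⟩ = k′ n_dof/n_step`, `k′ = 2τ_int·Δ²σ²`, as a
CERTIFIED UPPER ENVELOPE for the work variance of ANY such layers (the AR(1) model
`Scaling/AR1SwitchingLaw` attains the form with equality). -/
theorem layerWorkVar_uniform_le [Nonempty X] (S₀ D : X → ℝ) (P : ℕ → X → X → ℝ)
    (hP : ∀ k, IsRowStochastic (P k)) {n : ℕ} (hn : n ≠ 0) {ΔD ρ σbar θ εbar : ℝ}
    (hD : ∀ x y, |D x - D y| ≤ ΔD)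
    (hK : ∀ k, ChiSqContracts (P k) (gibbsLaw (linAction S₀ D (((k + 1 : ℕ) : ℝ) / n))) ρ)
    (hst : ∀ k, IsStationary
      (fun x => Real.exp (-(linAction S₀ D (((k + 1 : ℕ) : ℝ) / n) x))) (P k))
    (hρ : 0 ≤ ρ) (hσ0 : 0 ≤ σbar) (hσ : ∀ c, varD S₀ D c ≤ σbar ^ 2)
    (hθ : θ = ρ * Real.exp (ΔD / (2 * n))) (hθ1 : θ < 1)
    (hε : εbar = Real.sqrt (θ / (1 - θ) * (σbar / n) * ΔD * σbar)) :
    layerWorkVar S₀ D (fun k => (k : ℝ) / n) P n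
      ≤ (1 / n) * ((σbar + εbar)
          * (σbar * ((1 + θ) / (1 - θ)) + εbar * ((1 + Real.sqrt θ) / (1 - Real.sqrt θ)))) := by
  have hθ0 : 0 ≤ θ := by rw [hθ]; positivity
  have hε0 : 0 ≤ εbar := by rw [hε]; exact Real.sqrt_nonneg _
  have hsθ0 : 0 ≤ Real.sqrt θ := Real.sqrt_nonneg θ
  have hsθ1 : Real.sqrt θ < 1 := (Real.sqrt_lt' one_pos).mpr (by rw [one_pow]; exact hθ1)
  have hn' : (0 : ℝ) < n := Nat.cast_pos.mpr (Nat.pos_of_ne_zero hn)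
  have hProw : ∀ k x, ∑ y, P k x y = 1 := fun k => (hP k).2
  rw [layerWorkVar_eq_sum_sum S₀ D _ P hProw n]
  simp only [Nat.cast_zero, zero_div]
  -- the pair bound with the distance |j − k|
  set β : ℕ → ℝ := fun d => (σbar + εbar) * (σbar * θ ^ d + εbar * Real.sqrt θ ^ d) with hβ
  have hpair : ∀ j k : Fin n,
      |∑ ω : Fin (n + 1) → X, pathLaw (gibbsLaw (linAction S₀ D 0)) (fun k : Fin n => P k) ω
          * ((D (ω (Fin.castSucc j))
                - ∑ y, evolveLaw P (gibbsLaw (linAction S₀ D 0)) j y * D y)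
              * (D (ω (Fin.castSucc k))
                - ∑ y, evolveLaw P (gibbsLaw (linAction S₀ D 0)) k y * D y))|
        ≤ β (((j : ℕ) - k) + ((k : ℕ) - j)) := by
    intro j k
    rcases Nat.lt_or_ge (k : ℕ) j with hkj | hjk
    swap
    · have e : ((j : ℕ) - k) + ((k : ℕ) - j) = (k : ℕ) - j := by omega
      rw [e]
      exact abs_twoTime_cov_le S₀ D P hP hn hD hK hst hρ hσ0 hσ hθ hθ1 hε (Fin.castSucc j)
        (Fin.castSucc k) ((k : ℕ) - j) (by simp; omega)
    · have e : ((j : ℕ) - k) + ((k : ℕ) - j) = (j : ℕ) - k := by omega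
      rw [e]
      have hsym := abs_twoTime_cov_le S₀ D P hP hn hD hK hst hρ hσ0 hσ hθ hθ1 hε
        (Fin.castSucc k) (Fin.castSucc j) ((j : ℕ) - k) (by simp; omega)
      have eqsum : ∑ ω : Fin (n + 1) → X,
          pathLaw (gibbsLaw (linAction S₀ D 0)) (fun k : Fin n => P k) ω
            * ((D (ω (Fin.castSucc j))
                  - ∑ y, evolveLaw P (gibbsLaw (linAction S₀ D 0)) j y * D y)
                * (D (ω (Fin.castSucc k))
                  - ∑ y, evolveLaw P (gibbsLaw (linAction S₀ D 0)) k y * D y))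
        = ∑ ω : Fin (n + 1) → X,
          pathLaw (gibbsLaw (linAction S₀ D 0)) (fun k : Fin n => P k) ω
            * ((D (ω (Fin.castSucc k))
                  - ∑ y, evolveLaw P (gibbsLaw (linAction S₀ D 0)) k y * D y)
                * (D (ω (Fin.castSucc j))
                  - ∑ y, evolveLaw P (gibbsLaw (linAction S₀ D 0)) j y * D y)) :=
        sum_congr rfl fun ω _ => by ring
      rw [eqsum]
      exact hsym
  -- uniform grid factors
  have hδ : ∀ k : Fin n, ((((k : ℕ) + 1 : ℕ) : ℝ) / n - ((k : ℕ) : ℝ) / n) = 1 / n := fun k =>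
    succ_div_sub_div hn k
  have step1 : ∀ j k : Fin n,
      ((((j : ℕ) + 1 : ℕ) : ℝ) / n - ((j : ℕ) : ℝ) / n) * ((((k : ℕ) + 1 : ℕ) : ℝ) / n - ((k : ℕ) : ℝ) / n)
        * ∑ ω : Fin (n + 1) → X, pathLaw (gibbsLaw (linAction S₀ D 0)) (fun k : Fin n => P k) ω
          * ((D (ω (Fin.castSucc j))
                - ∑ y, evolveLaw P (gibbsLaw (linAction S₀ D 0)) j y * D y)
              * (D (ω (Fin.castSucc k))
                - ∑ y, evolveLaw P (gibbsLaw (linAction S₀ D 0)) k y * D y))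
      ≤ (1 / n) ^ 2 * β (((j : ℕ) - k) + ((k : ℕ) - j)) := by
    intro j k
    rw [hδ j, hδ k, ← sq]
    exact mul_le_mul_of_nonneg_left ((le_abs_self _).trans (hpair j k)) (by positivity)
  have g1 := sum_sum_pow_natDist_le hθ0 hθ1 n
  have g2 := sum_sum_pow_natDist_le hsθ0 hsθ1 n
  simp only [Finset.sum_range] at g1 g2
  have hσε : 0 ≤ σbar + εbar := by positivity
  have esplit : ∀ j k : Fin n, (1 / (n : ℝ)) ^ 2 * β (((j : ℕ) - k) + ((k : ℕ) - j))
      = ((1 / (n : ℝ)) ^ 2 * (σbar + εbar) * σbar) * θ ^ (((j : ℕ) - k) + ((k : ℕ) - j))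
        + ((1 / (n : ℝ)) ^ 2 * (σbar + εbar) * εbar)
          * Real.sqrt θ ^ (((j : ℕ) - k) + ((k : ℕ) - j)) := by
    intro j k; simp only [hβ]; ring
  have step2 : ∑ j : Fin n, ∑ k : Fin n, (1 / (n : ℝ)) ^ 2 * β (((j : ℕ) - k) + ((k : ℕ) - j))
      ≤ ((1 / (n : ℝ)) ^ 2 * (σbar + εbar) * σbar) * (n * ((1 + θ) / (1 - θ)))
        + ((1 / (n : ℝ)) ^ 2 * (σbar + εbar) * εbar)
          * (n * ((1 + Real.sqrt θ) / (1 - Real.sqrt θ))) := by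
    simp_rw [esplit, sum_add_distrib, ← mul_sum]
    exact add_le_add (mul_le_mul_of_nonneg_left g1 (by positivity))
      (mul_le_mul_of_nonneg_left g2 (by positivity))
  calc ∑ j : Fin n, ∑ k : Fin n,
        ((((j : ℕ) + 1 : ℕ) : ℝ) / n - ((j : ℕ) : ℝ) / n)
          * ((((k : ℕ) + 1 : ℕ) : ℝ) / n - ((k : ℕ) : ℝ) / n)
          * ∑ ω : Fin (n + 1) → X, pathLaw (gibbsLaw (linAction S₀ D 0)) (fun k : Fin n => P k) ω
            * ((D (ω (Fin.castSucc j))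
                  - ∑ y, evolveLaw P (gibbsLaw (linAction S₀ D 0)) j y * D y)
                * (D (ω (Fin.castSucc k))
                  - ∑ y, evolveLaw P (gibbsLaw (linAction S₀ D 0)) k y * D y))
      ≤ ∑ j : Fin n, ∑ k : Fin n, (1 / (n : ℝ)) ^ 2 * β (((j : ℕ) - k) + ((k : ℕ) - j)) :=
        sum_le_sum fun j _ => sum_le_sum fun k _ => step1 j k
    _ ≤ _ := step2
    _ = (1 / n) * ((σbar + εbar)
          * (σbar * ((1 + θ) / (1 - θ)) + εbar * ((1 + Real.sqrt θ) / (1 - Real.sqrt θ)))) := by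
        field_simp

/-- **Reversible irreducible layers**: the work-variance law with `ρ = max_k λ⋆(P_k)` and no
other hypothesis on the layers (contraction from Levin–Peres (12.8), stationarity from detailed
balance). -/
theorem layerWorkVar_uniform_le_of_reversible [Nonempty X] [DecidableEq X] (S₀ D : X → ℝ)
    (P : ℕ → X → X → ℝ) {n : ℕ} (hn : n ≠ 0) {ΔD ρ σbar θ εbar : ℝ}
    (hD : ∀ x y, |D x - D y| ≤ ΔD) (hP : ∀ k, IsRowStochastic (P k))
    (hDB : ∀ k, DetailedBalance (gibbsLaw (linAction S₀ D (((k + 1 : ℕ) : ℝ) / n))) (P k))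
    (hirr : ∀ k, IsIrreducible (P k)) (hlam : ∀ k, lambdaStar (P k) ≤ ρ)
    (hσ0 : 0 ≤ σbar) (hσ : ∀ c, varD S₀ D c ≤ σbar ^ 2)
    (hθ : θ = ρ * Real.exp (ΔD / (2 * n))) (hθ1 : θ < 1)
    (hε : εbar = Real.sqrt (θ / (1 - θ) * (σbar / n) * ΔD * σbar)) :
    layerWorkVar S₀ D (fun k => (k : ℝ) / n) P n
      ≤ (1 / n) * ((σbar + εbar)
          * (σbar * ((1 + θ) / (1 - θ)) + εbar * ((1 + Real.sqrt θ) / (1 - Real.sqrt θ)))) := by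
  have hρ : 0 ≤ ρ := (lambdaStar_nonneg (P 0)).trans (hlam 0)
  have hDBexp : ∀ k, DetailedBalance
      (fun x => Real.exp (-(linAction S₀ D (((k + 1 : ℕ) : ℝ) / n) x))) (P k) := by
    intro k x y
    have h := hDB k x y
    have hZ := partitionFn_pos (linAction S₀ D (((k + 1 : ℕ) : ℝ) / n))
    unfold gibbsLaw at h
    field_simp at h
    linarith [h]
  refine layerWorkVar_uniform_le S₀ D P hP hn hD (fun k => ?_)
    (fun k => (hDBexp k).isStationary (hP k).2) hρ hσ0 hσ hθ hθ1 hε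
  exact (chiSqContracts_of_reversible (gibbsLaw_pos _) (sum_gibbsLaw _) (hP k) (hDB k)
    (hirr k)).mono (fun x => (gibbsLaw_pos _ x).le) (lambdaStar_nonneg _) (hlam k)

end Summit.Ventures.LatticeQCDFlow.Scaling
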